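import Literature.Analysis.FunctionSpaces.TorusHeatSmoothing
import HarnessLib

/-!
# Integral kernels of `ℝ^d` acting on fields of the flat torus: `L^p` bound, Fourier series, exchange of kernels

Analysis/FunctionSpaces support file (all results proved; no definitions, no named facts),
continuing `TorusHeatSmoothing` (the case `K = G_s` of the Gauss–Weierstrass kernel). For an
integrable kernel `K` on `ℝ^d = EuclideanSpace ℝ d` and a field `v` on `T^d = UnitAddTorus d`
the **kernel smoothing** is the torus function

  `x ↦ ∫_{ℝ^d} K(z) • v(x - proj z) dz`

(`K ⋆ (v ∘ proj)` read back on the torus; equivalently the torus convolution of `v` with the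
periodisation of `K`, Grafakos 2014, §3.1.1 and Thm. 4.3.7). The expression is used literally, as
in `TorusHeatSmoothing`. We prove:

* `Torus.eLpNorm_integral_kernel_smul_le` — `‖∫ K(z) v(· - proj z) dz‖_{L^p(T^d)} ≤ ‖K‖_{L¹(ℝ^d)} ‖v‖_{L^p(T^d)}`
  for continuous `v`, `1 ≤ p < ∞` (Minkowski–Jensen and translation invariance);
* `Torus.integral_ofReal_mul_mFourier_neg_proj` — `∫ K(z) e_k(-proj z) dz = 𝓕K(latticeVec k)`;
* `Torus.hasSum_integral_kernel_smul` — for a smooth real vector field `v`,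
  `∫ K(z) v(x - proj z) dz = ∑ₖ Re(𝓕K(latticeVec k) e_k(x) v̂(k))` (termwise integration of the
  absolutely convergent Fourier series of `v`): the kernel acts as the Fourier multiplier with
  symbol `k ↦ 𝓕K(latticeVec k)`;
* `Torus.integral_kernel_smul_eq_of_fourier_eq` — **exchange of kernels**: two integrable kernels
  whose Fourier transforms agree at the lattice points carrying the spectrum of `v` smooth `v`
  identically.

This serves the discharge of `Literature.Analysis.FluidPDE.Torus.rieszPotential_Lp_bound_of_freqSupport`
(`FluidPDE/TorusLpOperatorFacts`), where `G_t` is exchanged for `G_t - Ψ ⋆ G_t` on fields with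
spectrum in `{|k| ≥ κ}` (`UnboundedOperators/HeatKernelCancellation`).

## Mathlib / tree search

Mathlib: `hasSum_integral_of_dominated_convergence`, `eLpNorm_comp_measurePreserving`,
`measurePreserving_sub_right`, `Real.fourier_eq`. Tree (all reused): `Torus.eLpNorm_heatSmoothing_le`,
`Torus.hasSum_heatSmoothing`, `Torus.mFourier_proj_eq_fourierChar`,
`Torus.heatKernel_smul_mFourier_sub_smul` (`TorusHeatSmoothing`);
`Literature.Analysis.FunctionSpaces.eLpNorm_integral_smul_le_mul` (`TorusMollifierEstimates`);
`Torus.hasSum_realPart_mFourier_smul`, `Torus.summable_norm_mFourierCoeff_of_isSmooth`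
(`TorusFourierSeries`). Nothing for general kernels (`lean search 'proj z\)|kernel_smul.*Torus'`).

## References

* L. Grafakos, *Classical Fourier Analysis*, 3rd ed., GTM 249 (2014), §3.1.1 (periodic functions
  and periodisation), Thm. 1.2.10 (Young), Thm. 4.3.7 (transference of multipliers). [`Grafakos2014`]
-/

noncomputable section

open MeasureTheory Set Filter Function UnitAddTorus Complex
open Literature.Analysis.UnboundedOperators
open scoped ENNReal NNReal FourierTransform RealInnerProductSpace

namespace Literature.Analysis.FunctionSpaces

namespace Torus

variable {d : Type*} [Fintype d]

/-! ## The `L^p` bound (Minkowski–Jensen) -/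

section LpBound

variable {F : Type*} [NormedAddCommGroup F] [NormedSpace ℝ F]

/-- **Young/Minkowski bound for whole-space kernels acting on torus fields**: for an
a.e.-strongly measurable kernel `K` on `ℝ^d`, a continuous `v : T^d → F` and `1 ≤ p < ∞`,
`‖x ↦ ∫ K(z) v(x - proj z) dz‖_{L^p(T^d)} ≤ ‖K‖_{L¹(ℝ^d)} ‖v‖_{L^p(T^d)}` (Minkowski–Jensen
against the weight `|K|` and translation invariance of the Haar measure of `T^d`; the case
`K = G_s` is `Torus.eLpNorm_heatSmoothing_le`). This is the torus form of
`‖K ⋆ f‖_{L^p} ≤ ‖K‖_{L¹} ‖f‖_{L^p}` (Grafakos 2014, Thm. 1.2.10, for the periodisation of `K`).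
[folklore] -/
theorem eLpNorm_integral_kernel_smul_le {K : EuclideanSpace ℝ d → ℝ}
    (hK : AEStronglyMeasurable K volume) {v : UnitAddTorus d → F} (hv : Continuous v)
    {p : ℝ≥0∞} (hp : 1 ≤ p) (hp' : p ≠ ⊤) :
    eLpNorm (fun x => ∫ z : EuclideanSpace ℝ d, K z • v (x - proj z)) p volume ≤
      (∫⁻ z, ‖K z‖ₑ) * eLpNorm v p volume := by
  have hΦ : AEStronglyMeasurable
      (uncurry fun (x : UnitAddTorus d) (z : EuclideanSpace ℝ d) => v (x - proj z))
      ((volume : Measure (UnitAddTorus d)).prod volume) :=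
    (hv.comp (continuous_fst.sub (continuous_proj.comp continuous_snd))).aestronglyMeasurable
  have hA : ∀ᵐ z ∂(volume : Measure (EuclideanSpace ℝ d)), K z ≠ 0 →
      eLpNorm (fun x => v (x - proj z)) p volume ≤ eLpNorm v p volume := by
    refine Eventually.of_forall fun z _ => le_of_eq ?_
    exact eLpNorm_comp_measurePreserving (p := p) hv.aestronglyMeasurable
      (measurePreserving_sub_right (volume : Measure (UnitAddTorus d)) (proj z))
  exact eLpNorm_integral_smul_le_mul hK hΦ hp hp' hA

end LpBound

/-! ## Fourier series of the kernel smoothing of a smooth real vector field -/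

section Series

variable [DecidableEq d]

/-- **The kernel against a character**: `∫_{ℝ^d} K(z) e_k(-proj z) dz = 𝓕 K (latticeVec k)`
(the Fourier transform of `K` at the lattice point; Grafakos 2014, §3.1.1). [folklore] -/
theorem integral_ofReal_mul_mFourier_neg_proj (K : EuclideanSpace ℝ d → ℝ) (k : d → ℤ) :
    ∫ z : EuclideanSpace ℝ d, (K z : ℂ) * mFourier k (-proj z) =
      𝓕 (fun z : EuclideanSpace ℝ d => (K z : ℂ)) (latticeVec k) := by
  rw [Real.fourier_eq]
  congr 1
  funext z
  symm
  rw [Circle.smul_def, smul_eq_mul, mul_comm, ← proj_neg, mFourier_proj_eq_fourierChar,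
    inner_neg_left]

omit [DecidableEq d] in
/-- The character integrand `z ↦ K(z) e_k(-proj z)` is integrable for integrable `K`. [folklore] -/
theorem integrable_ofReal_mul_mFourier_neg_proj {K : EuclideanSpace ℝ d → ℝ}
    (hK : Integrable K volume) (k : d → ℤ) :
    Integrable (fun z : EuclideanSpace ℝ d => (K z : ℂ) * mFourier k (-proj z)) volume :=
  hK.ofReal.mul_bdd ((mFourier k).continuous.comp (continuous_proj.neg)).aestronglyMeasurable
    (c := 1) (Eventually.of_forall fun z =>
      ((mFourier k).norm_coe_le_norm (-proj z)).trans_eq mFourier_norm)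

/-- **Fourier series of a kernel smoothing.** For an integrable kernel `K` on `ℝ^d`, a smooth
real vector field `v` on `T^d` and `x ∈ T^d`,
`∫ K(z) v(x - proj z) dz = ∑ₖ Re (𝓕K(latticeVec k) e_k(x) v̂(k))` (absolutely convergent): the
pointwise Fourier series of `v` integrated termwise against `K` (dominated convergence; the case
`K = G_s` is `Torus.hasSum_heatSmoothing`). In other words the kernel acts on `T^d` as the Fourier
multiplier with symbol `k ↦ 𝓕K(k)` (Grafakos 2014, §3.1.1 and Thm. 4.3.7 (transference), smooth
case). [folklore] -/
theorem hasSum_integral_kernel_smul {K : EuclideanSpace ℝ d → ℝ} (hK : Integrable K volume)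
    {v : UnitAddTorus d → EuclideanSpace ℝ d} (hv : IsSmooth v) (x : UnitAddTorus d) :
    HasSum (fun k : d → ℤ => EuclideanSpace.realPart
        ((∫ z : EuclideanSpace ℝ d, (K z : ℂ) * mFourier k (-proj z)) •
          (mFourier k x • mFourierCoeff (EuclideanSpace.complexify ∘ v) k)))
      (∫ z : EuclideanSpace ℝ d, K z • v (x - proj z)) := by
  set c : (d → ℤ) → EuclideanSpace ℂ d := mFourierCoeff (EuclideanSpace.complexify ∘ v) with hc
  have hsum : Summable fun k => ‖c k‖ := summable_norm_mFourierCoeff_of_isSmooth hv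
  -- termwise integrands and their integrals
  set T : (d → ℤ) → EuclideanSpace ℝ d → EuclideanSpace ℝ d := fun k z =>
    K z • EuclideanSpace.realPart (mFourier k (x - proj z) • c k) with hT
  have hlim : ∀ z : EuclideanSpace ℝ d, HasSum (fun k => T k z) (K z • v (x - proj z)) :=
    fun z => (hasSum_realPart_mFourier_smul hv (x - proj z)).const_smul _
  have hmeas : ∀ k, AEStronglyMeasurable (T k) (volume : Measure (EuclideanSpace ℝ d)) := by
    intro k
    exact hK.aestronglyMeasurable.smul (EuclideanSpace.realPart.continuous.comp
      (((mFourier k).continuous.comp (continuous_const.sub continuous_proj)).smul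
        continuous_const)).aestronglyMeasurable
  have hbound : ∀ k, ∀ᵐ z ∂(volume : Measure (EuclideanSpace ℝ d)), ‖T k z‖ ≤ ‖K z‖ * ‖c k‖ := by
    intro k
    refine Eventually.of_forall fun z => ?_
    rw [hT, norm_smul]
    exact mul_le_mul_of_nonneg_left (norm_realPart_mFourier_smul_le k _ _) (norm_nonneg _)
  have hint : Integrable (fun z : EuclideanSpace ℝ d => ∑' k, ‖K z‖ * ‖c k‖) volume := by
    have : (fun z : EuclideanSpace ℝ d => ∑' k, ‖K z‖ * ‖c k‖) =
        fun z => ‖K z‖ * ∑' k, ‖c k‖ := funext fun z => tsum_mul_left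
    rw [this]
    exact hK.norm.mul_const _
  have h := hasSum_integral_of_dominated_convergence (fun k z => ‖K z‖ * ‖c k‖) hmeas hbound
    (Eventually.of_forall fun z => hsum.mul_left _) hint (Eventually.of_forall hlim)
  -- the value of each termwise integral
  have hterm : ∀ k, ∫ z, T k z = EuclideanSpace.realPart
      ((∫ z : EuclideanSpace ℝ d, (K z : ℂ) * mFourier k (-proj z)) • (mFourier k x • c k)) := by
    intro k
    have hTk : T k = fun z => EuclideanSpace.realPart
        (((K z : ℂ) * mFourier k (-proj z)) • (mFourier k x • c k)) := by
      funext z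
      rw [hT]
      dsimp only
      rw [← map_smul, heatKernel_smul_mFourier_sub_smul]
    rw [hTk, ContinuousLinearMap.integral_comp_comm _
      ((integrable_ofReal_mul_mFourier_neg_proj hK k).smul_const _), integral_smul_const]
  have hfun : (fun k => ∫ z, T k z) = fun k => EuclideanSpace.realPart
      ((∫ z : EuclideanSpace ℝ d, (K z : ℂ) * mFourier k (-proj z)) • (mFourier k x • c k)) :=
    funext hterm
  rw [hfun] at h
  exact h

/-- **Exchange of kernels on a field with restricted spectrum.** If two integrable kernels
`K, K'` on `ℝ^d` have the same Fourier transform at every lattice point `latticeVec k` carrying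
a non-zero Fourier coefficient of the smooth real field `v`, then they smooth `v` identically:
`∫ K(z) v(x - proj z) dz = ∫ K'(z) v(x - proj z) dz` (termwise comparison of the Fourier series
`hasSum_integral_kernel_smul`). [folklore] -/
theorem integral_kernel_smul_eq_of_fourier_eq {K K' : EuclideanSpace ℝ d → ℝ}
    (hK : Integrable K volume) (hK' : Integrable K' volume)
    {v : UnitAddTorus d → EuclideanSpace ℝ d} (hv : IsSmooth v)
    (h : ∀ k : d → ℤ, mFourierCoeff (EuclideanSpace.complexify ∘ v) k ≠ 0 →
      𝓕 (fun z : EuclideanSpace ℝ d => (K z : ℂ)) (latticeVec k) =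
        𝓕 (fun z : EuclideanSpace ℝ d => (K' z : ℂ)) (latticeVec k))
    (x : UnitAddTorus d) :
    ∫ z : EuclideanSpace ℝ d, K z • v (x - proj z) = ∫ z : EuclideanSpace ℝ d, K' z • v (x - proj z) := by
  have h1 := hasSum_integral_kernel_smul hK hv x
  have h2 := hasSum_integral_kernel_smul hK' hv x
  have hfun : (fun k : d → ℤ => EuclideanSpace.realPart
      ((∫ z : EuclideanSpace ℝ d, (K z : ℂ) * mFourier k (-proj z)) •
        (mFourier k x • mFourierCoeff (EuclideanSpace.complexify ∘ v) k))) =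
      fun k => EuclideanSpace.realPart
        ((∫ z : EuclideanSpace ℝ d, (K' z : ℂ) * mFourier k (-proj z)) •
          (mFourier k x • mFourierCoeff (EuclideanSpace.complexify ∘ v) k)) := by
    funext k
    by_cases hk : mFourierCoeff (EuclideanSpace.complexify ∘ v) k = 0
    · simp only [hk, smul_zero]
    · rw [integral_ofReal_mul_mFourier_neg_proj, integral_ofReal_mul_mFourier_neg_proj, h k hk]
  rw [hfun] at h1
  exact h1.unique h2

end Series

end Torus

end Literature.Analysis.FunctionSpaces
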